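import Mathlib
import Literature.NumberTheory.Transcendental.SemialgebraicMapsProofs
import Literature.NumberTheory.Transcendental.SemialgebraicVolume
import Literature.ModelTheory.ExponentialFields.SemialgebraicInterior

/-!
# Crux `SymplecticScissors.PlanarSAZylev` (stmt-KontsevichZagierPeriods-9848), line `reservoir-peeling`,
stub `stub_teSymm`: symmetry of the pseudogroup equivalence

The pinned relation `E A B` says: an open co-null `ℚ`-semialgebraic part `U` of `A` is carried by
one `ℚ`-semialgebraic `C¹` injection `Φ` with `|det DΦ| = 1` onto a co-null part of `B`.  We prove
`E A B → E B A` by inverting the witness: `V := Φ '' U`, `Ψ := Function.invFunOn Φ U` (the inverse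
of `Φ` on `V`).

* `V` is open: at `p ∈ U` the map `Φ` is strictly differentiable (it is `C¹` on the open set `U`)
  with derivative of determinant `±1`, hence a continuous linear equivalence, so by the inverse
  function theorem `map Φ (𝓝 p) = 𝓝 (Φ p)` (`HasStrictFDerivAt.map_nhds_eq_of_equiv`) and
  `Φ '' U ∈ 𝓝 (Φ p)`.
* `V` is `ℚ`-semialgebraic: image of a semialgebraic set under a semialgebraic map
  (Tarski–Seidenberg, `IsSemialgebraicMapOn.isSemialgebraic_image_holds`).
* `Ψ` is `ℚ`-semialgebraic on `V`: its graph over `V` is the block swap of the graph of `Φ` over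
  `U` (`IsSemialgebraic.preimage_comp`).
* `Ψ` is `C¹` on `V` with `|det DΨ| = 1`: near `Φ p`, `Ψ` agrees with Mathlib's local inverse
  (`HasStrictFDerivAt.localInverse_unique`), which is `C¹` (`ContDiffAt.to_localInverse`), and
  `DΨ (Φ p) = (DΦ p)⁻¹` (`HasStrictFDerivAt.to_local_left_inverse`), whose determinant is
  `(det DΦ p)⁻¹`.
* `Ψ '' V = U` (`Set.InjOn.invFunOn_image`), so the measure conditions are the given ones.

Sources: the inverse function theorem (Mathlib, `Mathlib/Analysis/Calculus/InverseFunctionTheorem`);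
Bochnak–Coste–Roy 1998, §2.2 (semialgebraic maps).  Everything here is folklore bookkeeping.
-/

noncomputable section

open MeasureTheory Set Filter Topology
open Literature.NumberTheory.Transcendental Literature.ModelTheory.ExponentialFields

namespace Summit.KontsevichZagierPeriods.SymplecticScissors.PlanarSAZylev

/-- On an open set `U`, a map which is `C¹` on `U` with `|det (fderiv ℝ Φ p)| = 1` has at every
`p ∈ U` a strict derivative which is a continuous linear equivalence (namely `fderiv ℝ Φ p`).
[folklore] -/
theorem teSymm_hasStrictFDerivAt {U : Set (Fin 2 → ℝ)} {Φ : (Fin 2 → ℝ) → (Fin 2 → ℝ)}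
    (hUo : IsOpen U) (hΦC1 : ContDiffOn ℝ 1 Φ U) (hdet : ∀ p ∈ U, |(fderiv ℝ Φ p).det| = 1)
    {p : Fin 2 → ℝ} (hp : p ∈ U) :
    ∃ e : (Fin 2 → ℝ) ≃L[ℝ] (Fin 2 → ℝ), (e : (Fin 2 → ℝ) →L[ℝ] (Fin 2 → ℝ)) = fderiv ℝ Φ p ∧
      HasStrictFDerivAt Φ (e : (Fin 2 → ℝ) →L[ℝ] (Fin 2 → ℝ)) p := by
  have hne : (fderiv ℝ Φ p).det ≠ 0 := fun h => by simpa [h] using hdet p hp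
  refine ⟨(fderiv ℝ Φ p).toContinuousLinearEquivOfDetNeZero hne, by simp, ?_⟩
  rw [ContinuousLinearMap.coe_toContinuousLinearEquivOfDetNeZero]
  exact (hΦC1.contDiffAt (hUo.mem_nhds hp)).hasStrictFDerivAt one_ne_zero

/-- **Open mapping.** The image of an open set `U` under a map which is `C¹` on `U` with
`|det (fderiv ℝ Φ p)| = 1` on `U` is open (inverse function theorem). [folklore] -/
theorem teSymm_isOpen_image {U : Set (Fin 2 → ℝ)} {Φ : (Fin 2 → ℝ) → (Fin 2 → ℝ)}
    (hUo : IsOpen U) (hΦC1 : ContDiffOn ℝ 1 Φ U) (hdet : ∀ p ∈ U, |(fderiv ℝ Φ p).det| = 1) :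
    IsOpen (Φ '' U) := by
  rw [isOpen_iff_mem_nhds]
  rintro _ ⟨p, hp, rfl⟩
  obtain ⟨e, -, he⟩ := teSymm_hasStrictFDerivAt hUo hΦC1 hdet hp
  rw [← he.map_nhds_eq_of_equiv]
  exact image_mem_map (hUo.mem_nhds hp)

/-- Near a point of the open set `U`, `Function.invFunOn Φ U` is a left inverse of the injection
`Φ`. [folklore] -/
theorem teSymm_eventually_left_inverse {U : Set (Fin 2 → ℝ)} {Φ : (Fin 2 → ℝ) → (Fin 2 → ℝ)}
    (hUo : IsOpen U) (hinj : InjOn Φ U) {p : Fin 2 → ℝ} (hp : p ∈ U) :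
    ∀ᶠ x in 𝓝 p, Function.invFunOn Φ U (Φ x) = x :=
  eventually_of_mem (hUo.mem_nhds hp) fun _ hx => hinj.leftInvOn_invFunOn hx

/-- **Regularity of the inverse.** If `Φ` is `C¹` and injective on the open set `U` with
`|det (fderiv ℝ Φ p)| = 1`, then `Function.invFunOn Φ U` is `C¹` at every point of `Φ '' U`: it
agrees near `Φ p` with the local inverse of the inverse function theorem. [folklore] -/
theorem teSymm_contDiffAt_invFunOn {U : Set (Fin 2 → ℝ)} {Φ : (Fin 2 → ℝ) → (Fin 2 → ℝ)}
    (hUo : IsOpen U) (hΦC1 : ContDiffOn ℝ 1 Φ U) (hinj : InjOn Φ U)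
    (hdet : ∀ p ∈ U, |(fderiv ℝ Φ p).det| = 1) {p : Fin 2 → ℝ} (hp : p ∈ U) :
    ContDiffAt ℝ 1 (Function.invFunOn Φ U) (Φ p) := by
  obtain ⟨e, -, he⟩ := teSymm_hasStrictFDerivAt hUo hΦC1 hdet hp
  have hca : ContDiffAt ℝ 1 Φ p := hΦC1.contDiffAt (hUo.mem_nhds hp)
  refine (hca.to_localInverse he.hasFDerivAt one_ne_zero).congr_of_eventuallyEq ?_
  exact he.localInverse_unique (teSymm_eventually_left_inverse hUo hinj hp)

/-- `Function.invFunOn Φ U` is `C¹` on `Φ '' U` under the hypotheses of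
`teSymm_contDiffAt_invFunOn`. [folklore] -/
theorem teSymm_contDiffOn_invFunOn {U : Set (Fin 2 → ℝ)} {Φ : (Fin 2 → ℝ) → (Fin 2 → ℝ)}
    (hUo : IsOpen U) (hΦC1 : ContDiffOn ℝ 1 Φ U) (hinj : InjOn Φ U)
    (hdet : ∀ p ∈ U, |(fderiv ℝ Φ p).det| = 1) :
    ContDiffOn ℝ 1 (Function.invFunOn Φ U) (Φ '' U) := by
  rintro _ ⟨p, hp, rfl⟩
  exact (teSymm_contDiffAt_invFunOn hUo hΦC1 hinj hdet hp).contDiffWithinAt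

/-- **Jacobian of the inverse.** Under the same hypotheses, `|det (fderiv ℝ Ψ q)| = 1` on
`Φ '' U` for `Ψ := Function.invFunOn Φ U`: `fderiv ℝ Ψ (Φ p) = (fderiv ℝ Φ p)⁻¹`, whose
determinant is `(det (fderiv ℝ Φ p))⁻¹`. [folklore] -/
theorem teSymm_det_invFunOn {U : Set (Fin 2 → ℝ)} {Φ : (Fin 2 → ℝ) → (Fin 2 → ℝ)}
    (hUo : IsOpen U) (hΦC1 : ContDiffOn ℝ 1 Φ U) (hinj : InjOn Φ U)
    (hdet : ∀ p ∈ U, |(fderiv ℝ Φ p).det| = 1) :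
    ∀ q ∈ Φ '' U, |(fderiv ℝ (Function.invFunOn Φ U) q).det| = 1 := by
  rintro _ ⟨p, hp, rfl⟩
  obtain ⟨e, hefd, he⟩ := teSymm_hasStrictFDerivAt hUo hΦC1 hdet hp
  have hΨ : HasStrictFDerivAt (Function.invFunOn Φ U)
      ((e.symm : (Fin 2 → ℝ) ≃L[ℝ] (Fin 2 → ℝ)) : (Fin 2 → ℝ) →L[ℝ] (Fin 2 → ℝ)) (Φ p) :=
    he.to_local_left_inverse (teSymm_eventually_left_inverse hUo hinj hp)
  rw [hΨ.hasFDerivAt.fderiv, ContinuousLinearEquiv.det_coe_symm, hefd, abs_inv, hdet p hp, inv_one]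

/-- **Graph of the inverse.** For `Φ` injective on `U`, the graph of `Function.invFunOn Φ U` over
`Φ '' U` is the preimage of the graph of `Φ` over `U` under the swap of the two coordinate blocks of
`Fin (2 + 2)`. [folklore] -/
theorem teSymm_graph_invFunOn {U : Set (Fin 2 → ℝ)} {Φ : (Fin 2 → ℝ) → (Fin 2 → ℝ)}
    (hinj : InjOn Φ U) :
    {z : Fin (2 + 2) → ℝ | ∃ y ∈ Φ '' U, z = Fin.append y (Function.invFunOn Φ U y)} =
      (fun z : Fin (2 + 2) → ℝ => z ∘ Fin.append (fun i : Fin 2 => (Fin.natAdd 2 i : Fin (2 + 2)))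
          (fun j : Fin 2 => (Fin.castAdd 2 j : Fin (2 + 2)))) ⁻¹'
        {z : Fin (2 + 2) → ℝ | ∃ x ∈ U, z = Fin.append x (Φ x)} := by
  ext z
  simp only [mem_setOf_eq, mem_preimage]
  constructor
  · rintro ⟨_, ⟨x, hx, rfl⟩, rfl⟩
    refine ⟨x, hx, ?_⟩
    rw [hinj.leftInvOn_invFunOn hx]
    funext i
    induction i using Fin.addCases with
    | left i => simp only [Function.comp_apply, Fin.append_left, Fin.append_right]
    | right j => simp only [Function.comp_apply, Fin.append_right, Fin.append_left]
  · rintro ⟨x, hx, hz⟩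
    refine ⟨Φ x, ⟨x, hx, rfl⟩, ?_⟩
    rw [hinj.leftInvOn_invFunOn hx]
    funext i
    induction i using Fin.addCases with
    | left j =>
      have h := congr_fun hz (Fin.natAdd 2 j)
      simp only [Function.comp_apply, Fin.append_right] at h
      simpa only [Fin.append_left] using h
    | right i =>
      have h := congr_fun hz (Fin.castAdd 2 i)
      simp only [Function.comp_apply, Fin.append_left] at h
      simpa only [Fin.append_right] using h

/-- **Semialgebraicity of the inverse.** If `Φ` is a `ℚ`-semialgebraic map on `U`, injective on
`U`, then `Function.invFunOn Φ U` is a `ℚ`-semialgebraic map on `Φ '' U` (its graph is a coordinate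
permutation of the graph of `Φ`; Bochnak–Coste–Roy 1998, Prop. 2.2.6 ff.). [folklore] -/
theorem teSymm_isSemialgebraicMapOn_invFunOn {U : Set (Fin 2 → ℝ)} {Φ : (Fin 2 → ℝ) → (Fin 2 → ℝ)}
    (hΦsa : IsSemialgebraicMapOn ℚ U Φ) (hinj : InjOn Φ U) :
    IsSemialgebraicMapOn ℚ (Φ '' U) (Function.invFunOn Φ U) := by
  unfold IsSemialgebraicMapOn at hΦsa ⊢
  rw [teSymm_graph_invFunOn hinj]
  exact hΦsa.preimage_comp _

/-- **Inverting a witness.** From a witness `(U, Φ)` of `E A B` (open co-null semialgebraic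
`U ⊆ A`, `Φ` a semialgebraic `C¹` injection on `U` with `|det DΦ| = 1` onto a co-null part of `B`)
we get the witness `(Φ '' U, Function.invFunOn Φ U)` of `E B A`. [folklore] -/
theorem teSymm_inverse {A B U : Set (Fin 2 → ℝ)} {Φ : (Fin 2 → ℝ) → (Fin 2 → ℝ)}
    (hUA : U ⊆ A) (hUsa : IsSemialgebraic ℚ U) (hUo : IsOpen U) (hAU : volume (A \ U) = 0)
    (hΦsa : IsSemialgebraicMapOn ℚ U Φ) (hΦC1 : ContDiffOn ℝ 1 Φ U) (hinj : InjOn Φ U)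
    (hdet : ∀ p ∈ U, |(fderiv ℝ Φ p).det| = 1) (hΦB : Φ '' U ⊆ B)
    (hBΦ : volume (B \ Φ '' U) = 0) :
    ∃ (V : Set (Fin 2 → ℝ)) (Ψ : (Fin 2 → ℝ) → (Fin 2 → ℝ)),
      V ⊆ B ∧ IsSemialgebraic ℚ V ∧ IsOpen V ∧ volume (B \ V) = 0 ∧
      IsSemialgebraicMapOn ℚ V Ψ ∧ ContDiffOn ℝ 1 Ψ V ∧ InjOn Ψ V ∧
      (∀ q ∈ V, |(fderiv ℝ Ψ q).det| = 1) ∧ Ψ '' V ⊆ A ∧ volume (A \ Ψ '' V) = 0 := by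
  have himg : Function.invFunOn Φ U '' (Φ '' U) = U := hinj.invFunOn_image subset_rfl
  refine ⟨Φ '' U, Function.invFunOn Φ U, hΦB, ?_, teSymm_isOpen_image hUo hΦC1 hdet, hBΦ,
    teSymm_isSemialgebraicMapOn_invFunOn hΦsa hinj, teSymm_contDiffOn_invFunOn hUo hΦC1 hinj hdet,
    Function.invFunOn_injOn_image Φ U, teSymm_det_invFunOn hUo hΦC1 hinj hdet, ?_, ?_⟩
  · exact IsSemialgebraicMapOn.isSemialgebraic_image_holds hΦsa subset_rfl hUsa
  · rw [himg]
    exact hUA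
  · rw [himg]
    exact hAU

/-- **Symmetry of the pseudogroup equivalence** (stub `stub_teSymm` of crux
`SymplecticScissors.PlanarSAZylev`, line `reservoir-peeling`): for the pinned relation `E`, the
inverse of a `C¹` semialgebraic injection with `|det| = 1` on an open set is again one, on the
(open) image, so `E A B → E B A`. [folklore] -/
theorem stub_teSymm :
    ∀ (E : Set (Fin 2 → ℝ) → Set (Fin 2 → ℝ) → Prop),
      (∀ A B : Set (Fin 2 → ℝ), E A B ↔
        ∃ (U : Set (Fin 2 → ℝ)) (Φ : (Fin 2 → ℝ) → (Fin 2 → ℝ)),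
          U ⊆ A ∧ IsSemialgebraic ℚ U ∧ IsOpen U ∧ volume (A \ U) = 0 ∧
          IsSemialgebraicMapOn ℚ U Φ ∧ ContDiffOn ℝ 1 Φ U ∧ InjOn Φ U ∧
          (∀ p ∈ U, |(fderiv ℝ Φ p).det| = 1) ∧ Φ '' U ⊆ B ∧ volume (B \ Φ '' U) = 0) →
    ∀ A B : Set (Fin 2 → ℝ), E A B → E B A := by
  intro E HE A B h
  obtain ⟨U, Φ, hUA, hUsa, hUo, hAU, hΦsa, hΦC1, hinj, hdet, hΦB, hBΦ⟩ := (HE A B).1 h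
  exact (HE B A).2 (teSymm_inverse hUA hUsa hUo hAU hΦsa hΦC1 hinj hdet hΦB hBΦ)

end Summit.KontsevichZagierPeriods.SymplecticScissors.PlanarSAZylev
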